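import Summits.ResolutionOfSingularities.ResolutionOfSingularities.Theorems.TeissierResolve.Negative.IsReducedLoadBearing
import Summits.ResolutionOfSingularities.ResolutionOfSingularities.Theorems.TeissierResolve.Negative.IsFiniteLoadBearing

/-!
# Disproof of `TeissierResolve` (stmt-ResolutionOfSingularities-17086) — findings

Standing disprover's work file (cdisprove gen 1, cycle 1, 2026-08-17; route
`route-ResolutionOfSingularities-TeissierJung`, crux rank 3; the crux is wanted by this route
only). Prose lives in docstrings; everything outside §E is kernel-checked and sorry-free (§E
states the one remaining near-miss as a `sorry`d theorem with its informal witness). The proved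
negative lemmas are LANDED under `Theorems/TeissierResolve/Negative/` and imported here:
`IsReducedLoadBearing.lean` (p150458) and `IsFiniteLoadBearing.lean` (p152131), both ACCEPTED.

THE CRUX `C` (`teissierResolve_iff`): for every prime `p`, every algebraically closed field `k`
of characteristic `p` and every scheme `X'`,
`TeissierPresented k X' → Scheme.HasResolution X'`, where `TeissierPresented k X'`
(`Literature/AlgebraicGeometry/Resolution/TeissierPresentation.lean`, `teissierPresented_iff` =
the let-bound `TF` of the route VERBATIM) says: `X'` is INTEGRAL and FINITE over a regular
integral separated finite-type `k`-scheme `S` (`π : X' → S`, `g : S → Spec k`), and at every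
closed point `x`, every analytic branch `𝒪̂_{X',x} ⧸ P` (`P` a minimal prime of the completed
local ring) is ring-isomorphic to an overweight-deformed binomial tower
`k⟦x₁..x_d⟧[u₀..u_{g-1}] ⧸ (E₀..E_{g-1})` (Mourtada–Schober 2025 §3) compatibly with an
isomorphism `φ : 𝒪̂_{S,π x} ≅ k⟦x₁..x_d⟧` and the stalk map of `π`.

## VERDICT (cycle 1): NO KILL — the crux is irrefutable relative to the summit
`ResolutionOfSingularities → C` (`teissierResolve_of_resolutionOfSingularities`,
`not_resolutionOfSingularities_of_not_teissierResolve`): a Teissier-presented `X'` is a reduced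
separated `k`-scheme of finite type, so every counterexample to `C` is a counterexample to
resolution of singularities in characteristic `p`; modulo `CossartPiltant2019` it has dimension
`≥ 4` (`teissierResolve_of_dim_le_three`). No finite / decidable / computable instance exists
(no `decide`, no `kit compute` attack applies); the printed source (MS 2025 Thm. 3.2) is
ANNOUNCED, so no published counterexample can exist either. What CAN be attacked is the typing:
which hypotheses of `TF` carry weight, and whether `TF` is satisfiable by junk.

## INDEX OF FINDINGS
* §A RESTATEMENT / IRREFUTABILITY: `Negative.teissierResolve_iff` (landed);
  `teissierResolve_of_resolutionOfSingularities`;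
  `Negative.not_resolutionOfSingularities_of_not_teissierResolve` (landed);
  `teissierResolve_of_dim_le_three` (content of the crux = dimension `≥ 4`, modulo the vendored
  `CossartPiltant2019`).
* §B LOAD-BEARING ANALYSIS (one entry per hypothesis of `TF`):
  - `IsIntegral X'` — its REDUCEDNESS half is LOAD-BEARING and this is PROVED:
    `Negative.teissierResolve_false_without_isReduced` (every prime; witness the fat point
    `Spec 𝔽̄_p[ε] → Spec 𝔽̄_p`, `Negative.specDualNumber_teissierBranches`: every other conjunct of `TF`
    holds, the unique branch `k[ε]/(ε) = k = k⟦∅⟧` being Teissier-presented with `d = g = 0`;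
    no resolution by `not_hasResolution_spec_dualNumber`). LANDED as
    `Theorems/TeissierResolve/Negative/IsReducedLoadBearing.lean` (p150458, ACCEPTED). MORAL: the branch
    condition sees `𝒪̂_{X',x}` only modulo MINIMAL primes — it is blind to nilpotent and embedded
    structure; a proof must use that `𝒪̂_{X',x}` is reduced (true for `X'` integral, finite over
    the excellent `S`: Matsumura 1986 §32 Remark 1), i.e. that `𝒪̂_{X',x} ↪ ∏_P 𝒪̂ ⧸ P`.
    Its IRREDUCIBILITY half is NOT load-bearing for truth: a reduced `X'` all of whose components
    satisfy the branch condition is resolved componentwise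
    (`hasResolution_of_irreducibleComponents` in the tree) — not attacked further.
  - `IsFinite π` — LOAD-BEARING and this is PROVED: `Negative.teissierResolve_false_without_isFinite`
    (every prime; witness `X' = Spec 𝔽̄_p[X]⁺ → Spec 𝔽̄_p`, the absolute integral closure of the
    affine line: integral, NOT of finite type; every closed point has square-root closed stalk,
    hence idempotent maximal ideal `𝔪 = 𝔪²`, so `𝒪̂_{X',x} = 𝒪/𝔪 = k`
    (`Negative.bijective_quotient_adicCompletion_of_idempotent`,
    `Negative.absoluteIntegralClosure_exists_sub_mem`) and the branch condition holds with
    `d = g = 0` (`Negative.specAbsoluteIntegralClosure_teissierBranches`); no resolution: tree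
    `not_hasResolution_spec_absoluteIntegralClosure`). LANDED as
    `Theorems/TeissierResolve/Negative/IsFiniteLoadBearing.lean` (p152131, ACCEPTED). MORAL: the ONLY
    Noetherianity in `TF` enters through `IsFinite π` + finite type of `S`; the completion-based
    branch condition does not see it (a proof must use Krull's intersection theorem
    `𝒪_{X',x} ↪ 𝒪̂_{X',x}`, Matsumura 1986 Thm. 8.10).
  - `LocallyOfFiniteType g` (finite type of the regular base) — LOAD-BEARING (informal witness,
    §E `teissierResolve_false_without_locallyOfFiniteType`, sorry): a non-Japanese DVR
    `R = k⟦t⟧ ∩ k(t, u^p)` (`u ∈ k⟦t⟧` transcendental over `k(t)`), `S = Spec R` regular,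
    `X' = Spec R[u]`, `R[u] ≅ R[U]/(U^p − u^p)` integral and finite over `R`, closed-point
    completion `k⟦t⟧[U]/((U − u)^p)` with the single branch `k⟦t⟧` (`d = 1`, `g = 0`,
    `φ = id`); `X'` has NO resolution because its normalisation `k⟦t⟧ ∩ k(t,u)` is not finite
    over it (Krull–Akizuki, Matsumura 1986 §33: for a one-dimensional Noetherian local domain,
    completion reduced ⟺ normalisation finite; a resolution would dominate and hence equal the
    normalisation, finite by properness). EXCELLENCE of `S` is what the crux silently uses.
  - `Scheme.IsRegular S`, `IsIntegral S` — REDUNDANT WHERE IT MATTERS, not load-bearing: the datum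
    `φ : 𝒪̂_{S,π x} ≅ k⟦x⟧` already forces `S` regular at every image of a closed point (a
    Noetherian local ring with regular completion is regular), and `S` may be replaced by the
    reduced closed image of `π` — information for the planner (hygiene), no witness possible.
  - `IsSeparated g`, `QuasiCompact g` — NOT ATTACKABLE: dropping them keeps `X'` a reduced scheme
    locally of finite type over `k`; no such scheme without resolution is known. (They are NOT
    obviously implied by the summit either: resolving a non-separated / non-quasi-compact `X'`
    from bare existence of resolutions of its affine pieces needs gluing = canonicity.)
  - `IsAlgClosed k`, `CharP k p`, `p.Prime` — decoration relative to truth (the summit is stated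
    for all fields; `p = 0` would be Hironaka); they only fix the setting of MS 2025.
  - `IsClosed {x}` / `P ∈ minimalPrimes` — restricting the branch condition to closed points and
    minimal primes WEAKENS `TF`'s demands in the right direction (non-closed points of a
    finite-type `X'` specialise to closed ones); dropping `IsClosed` only strengthens the
    hypothesis, hence weakens the crux: harmless.
* §C NATURAL STRENGTHENINGS (recorded from the route review rreview-0817 and the crux attack
  rattack-17086; not re-proved here): "`TF X' → X'` regular" is FALSE (the cusp `z² = x³ → 𝔸¹`
  in characteristic 2 is Teissier-presented with `g = 1` at the origin), so `HasResolution` is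
  never witnessed by the identity; "`TF X' →` the normalisation of `X'` is regular" is FALSE from
  dimension 2 on (the normal singular surface `z² = x₁x₂ → 𝔸²` is Teissier-presented with
  `g = 1`, `n = 2`, `A = (1,1)`, `v = (½,½)`, `h = 0`). The sub-case "`g = 0` for every branch
  at every closed point" IS provable (reduced excellent `𝒪̂ ↪ ∏_P k⟦x⟧` ⇒ the normalisation is
  finite and regular; tree `Scheme.HasResolution.of_normalization`) — a prover's warm-up, not a
  refuter's target.
* §D TARGETS: none this cycle (`payload.stuck_stubs = []`, no line picked yet).
* §E NEAR-MISS: the `sorry`d load-bearing statement for `LocallyOfFiniteType g` above, with its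
  witness and the missing tree infrastructure named in the docstring.

## WHY IT RESISTS (for provers and the lead)
Not closable by logic or by any tree fact; not refutable without refuting resolution in char `p`.
The honest content beyond print: (1) MS 2025 Thm. 3.2 is announced ([MS1] in preparation) and is
FORMAL and PRESENTATION-DEPENDENT (a `t`-independent fan resolving the `𝒪_{C_p}`-lift); (2) the
crux needs these formal toric resolutions ALGEBRAISED (Artin approximation is not enough for an
actual morphism; one needs the resolution to be defined by blowing up an ideal approximable
modulo a high power of `𝔪`, cf. the tree's `ArithmeticalThreefoldsAlgebraization`) and GLUED
along the finite map to `S` — no canonical (hence gluable) toric resolution of Teissier or even of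
characteristic-zero quasi-ordinary germs in dimension `≥ 3` is in print (González Pérez 2003 is
embedded-toric but depends on the choice of good coordinates); (3) `TF` as typed admits the
"link-erased" complete-intersection towers (`h_i` may contain `u_{i+1}` linearly, weight
`v_{i+1} > n_i v_i`), a class wider than MS's hypersurface germs — any proof must handle them or
the planner must forbid `u_{i+1} ∈ supp h_i`. A kill, if one exists, is a kill of resolution of
singularities itself; the disprover's useful output is therefore the load-bearing map above.
-/

noncomputable section

open CategoryTheory AlgebraicGeometry TopologicalSpace IsLocalRing
open Literature.AlgebraicGeometry.Resolution
open Summit.ResolutionOfSingularities.ResolutionOfSingularities.Theorems.TeissierResolve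

set_option linter.dupNamespace false -- mandated namespace of this single-conjunct summit

namespace Summit.ResolutionOfSingularities.ResolutionOfSingularities.Cruxes.TeissierResolve.Disproof

/-! ## §A The summit implies the crux; dimension ≤ 3

(`Negative.teissierResolve_iff` and `Negative.not_resolutionOfSingularities_of_not_teissierResolve`
are landed in `Theorems/TeissierResolve/Negative/IsReducedLoadBearing.lean`.) -/

/-- `ResolutionOfSingularities → TeissierResolve`: the crux is a special case of the summit
statement (so it cannot be refuted without refuting resolution in characteristic `p`).
[folklore] -/
theorem teissierResolve_of_resolutionOfSingularities (hR : _root_.ResolutionOfSingularities) :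
    Theses.TeissierJung.TeissierResolve := by
  by_contra h
  exact Negative.not_resolutionOfSingularities_of_not_teissierResolve h hR

/-- Modulo the vendored `CossartPiltant2019`, the crux holds for every Teissier-presented `X'` of
dimension `≤ 3`: the content of the crux is dimension `≥ 4`. [cite: CossartPiltant2019, Thm. 1.1] -/
theorem teissierResolve_of_dim_le_three (hCP : CossartPiltant2019.{0}) {p : ℕ} (k : Type)
    [Field k] [CharP k p] {X' : Scheme.{0}} (hX' : TeissierPresented k X')
    (hdim : topologicalKrullDim X' ≤ 3) : Scheme.HasResolution X' := by
  obtain ⟨S, g, π, hsep, hlft, hqc, -, -, hint, hfin, -⟩ := hX'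
  haveI := hsep; haveI := hlft; haveI := hqc; haveI := hint; haveI := hfin
  exact hasResolution_of_dim_le_three hCP k X' (π ≫ g) hdim

/-! ## §B Load-bearing hypotheses (landed; re-exported here for the reader)

* reducedness of `X'`: `Negative.teissierResolve_false_without_isReduced` /
  `Negative.specDualNumber_teissierBranches` (`IsReducedLoadBearing.lean`);
* finiteness of `π`: `Negative.teissierResolve_false_without_isFinite` /
  `Negative.specAbsoluteIntegralClosure_teissierBranches` (`IsFiniteLoadBearing.lean`). -/

/-- Both proved load-bearing results in one line: at every prime, `TF` minus reducedness and `TF`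
minus `IsFinite π` each admit a scheme WITHOUT resolution (`Spec k[ε]`, resp. `Spec k[X]⁺`).
[folklore] -/
theorem loadBearing_summary (p : ℕ) [Fact p.Prime] :
    (¬ Scheme.HasResolution (Spec (.of (DualNumber (AlgebraicClosure (ZMod p)))))) ∧
    ¬ Scheme.HasResolution (Spec (.of ↥(integralClosure (Polynomial (AlgebraicClosure (ZMod p)))
      (AlgebraicClosure (RatFunc (AlgebraicClosure (ZMod p))))))) :=
  ⟨not_hasResolution_spec_dualNumber _,
    Theorems.DescentAlgclosedToPerfect.Negative.not_hasResolution_spec_absoluteIntegralClosure _⟩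

/-! ## §E NEAR-MISS: the finite type (excellence) of the base (informal witness; `sorry`) -/

/-- NEAR-MISS (not proved here): **`LocallyOfFiniteType g` (finite type, hence EXCELLENCE, of the
regular base) is load-bearing.** With it dropped the crux is false. Informal witness (any
algebraically closed `k` of characteristic `p`): choose `u ∈ k⟦t⟧` transcendental over `k(t)`,
`K = k(t, u^p) ⊂ k((t))`, `R = K ∩ k⟦t⟧` — a discrete valuation ring with uniformiser `t`, residue
field `k`, completion `k⟦t⟧`, containing `u^p` but not `u`; `S = Spec R` is regular, integral,
affine (separated, quasi-compact) but NOT locally of finite type over `k`. `X' = Spec R[u]`,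
`R[u] ≅ R[U]/(U^p - u^p)` a local domain, finite free of rank `p` over `R`; its completion is
`k⟦t⟧[U]/((U - u)^p)`, whose unique minimal prime `(U - u)` has branch `k⟦t⟧ = k⟦x₁⟧`
(`d = 1`, `g = 0`, `φ = ψ = id`): every conjunct of `TF` but `LocallyOfFiniteType g` holds. `X'`
has NO resolution: its normalisation `R' = k⟦t⟧ ∩ K(u)` is a DVR with completion `k⟦t⟧`, so
`R'` finite over `R` would force `p = rank_R R' = rank_{k⟦t⟧} R̂' = 1`; and a resolution
`X̃ → X'` would, by the valuative criterion and the dimension inequality, have a local ring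
dominated by and birational to `R'`, hence equal to `R'` and essentially of finite type and
integral over `R[u]`, hence finite — contradiction (Krull–Akizuki; Matsumura 1986 §33:
for a one-dimensional Noetherian local domain, reduced completion ⟺ finite normalisation).
Missing for a Lean proof: the non-Japanese DVR itself (transcendence of some `u ∈ k⟦t⟧`,
`K ∩ k⟦t⟧` is a DVR with completion `k⟦t⟧`) and "resolution of `Spec` of a one-dimensional
local domain ⇒ finite normalisation". MORAL: the crux silently uses that `S` (hence `X'`) is
EXCELLENT: over a regular but non-excellent base there are integral finite covers,
Teissier-presented at every closed point (the non-reducedness of `𝒪̂_{X',x}` is invisible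
modulo its minimal prime), with no resolution. [folklore] -/
theorem teissierResolve_false_without_locallyOfFiniteType (p : ℕ) [Fact p.Prime] :
    ¬ ∀ (k : Type) [Field k] [CharP k p] [IsAlgClosed k] (X' : Scheme.{0}),
      (∃ (S : Scheme.{0}) (g : S ⟶ Spec (.of k)) (π : X' ⟶ S),
        IsSeparated g ∧ QuasiCompact g ∧ IsIntegral S ∧
        Scheme.IsRegular S ∧ IsIntegral X' ∧ IsFinite π ∧
        ∀ x : X', IsClosed ({x} : Set X') →
          ∀ P ∈ minimalPrimes
              (AdicCompletion (maximalIdeal (X'.presheaf.stalk x)) (X'.presheaf.stalk x)),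
            ∃ (d : ℕ)
              (φ : AdicCompletion (maximalIdeal (S.presheaf.stalk (π.base x)))
                  (S.presheaf.stalk (π.base x)) ≃+* MvPowerSeries (Fin d) k)
              (ι : MvPowerSeries (Fin d) k →+*
                AdicCompletion (maximalIdeal (X'.presheaf.stalk x)) (X'.presheaf.stalk x) ⧸ P),
              TeissierPresentation k d _ ι ∧
                ∀ a : S.presheaf.stalk (π.base x),
                  ι (φ (algebraMap _ _ a)) =
                    Ideal.Quotient.mk P (algebraMap _ _ ((π.stalkMap x).hom a))) →
      Scheme.HasResolution X' := by
  sorry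

end Summit.ResolutionOfSingularities.ResolutionOfSingularities.Cruxes.TeissierResolve.Disproof

end
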